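import Mathlib
import Summits.ValiantsHypothesis.ValiantsHypothesis.Theorems.RigidityForcesSymmetryRankRigidMinimalReprLaplaceFourDefs
import Summits.ValiantsHypothesis.ValiantsHypothesis.Theorems.RigidityForcesSymmetryRankRigidMinimalReprLaplaceFourContraction
import Summits.ValiantsHypothesis.ValiantsHypothesis.Theorems.RigidityForcesSymmetryRankRigidMinimalReprLaplaceFourLineCore
import Summits.ValiantsHypothesis.ValiantsHypothesis.Theorems.RigidityForcesSymmetryRankRigidMinimalReprLaplaceFourLinePsi
import Summits.ValiantsHypothesis.ValiantsHypothesis.Theorems.RigidityForcesSymmetryRankRigidMinimalReprLaplaceFourLineE3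

/-!
# LINE profiles with `02|13 + 03|12` rank-one part: reduction to the normal form (dichotomy)
# (crux `RankRigidMinimalRepr`, stmt-ValiantsHypothesis-18034, route `RigidityForcesSymmetry`)

For a decomposition of `P₄` with at most three noise terms in canonical position and rank-one part
`b(v₀,v₂)b′(v₁,v₃) + c(v₀,v₃)c′(v₁,v₂)`, stage A gives a line family; if it is a star, a letter relabelling and `e3_star`
give a contradiction; if it is a matching, a letter relabelling and `e3_matching` give the NORMAL FORM.  Hence
(`e3_dichotomy`): after relabelling the letters by a suitable `π`, the arrays `b∘π², b′∘π², c∘π², c′∘π²` are in the normal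
form of `matching_shape`.  This is the common first half of the profiles `(3,1,1)` and `slice+(2,1,1)`
(files `…LaplaceFourProfile311.lean`, `…LaplaceFourProfile211s.lean` to come).

HONEST FRAMING: finite algebra toward `LaplaceOptimal 4` (rung `TiedTorusBound 3`); the crux stays OPEN; nothing here
bears on `VP ≠ VNP`.
-/

set_option autoImplicit false

-- the mandated summit-side namespace repeats a component by design (single-problem summit)
set_option linter.dupNamespace false

namespace Summit.ValiantsHypothesis.ValiantsHypothesis.Theorems.RigidityForcesSymmetryRankRigidMinimalRepr

namespace LaplaceFourLine

open Matrix LaplaceFourContraction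

/-- From the decomposition and the vanishing of the noise along `d`: `Q(ℓφ,φ) = (Bψ)(B′φ)ᵀ + (C′φ)(Cψ)ᵀ`. -/
theorem q_eq_r_of_noise {ι : Type*} (N : Finset ι) (Xn : ι → (Fin 4 → Fin 4) → ℂ) (b b' c c' : Fin 4 → Fin 4 → ℂ)
    (hsum : ∀ v, permPattern₄ v = (∑ t ∈ N, Xn t v) + b (v 0) (v 2) * b' (v 1) (v 3) + c (v 0) (v 3) * c' (v 1) (v 2))
    (d : Fin 4 ⊕ (Fin 4 × Fin 4)) (hid : ∀ φ : Fin 4 → ℂ, ∑ t ∈ N, contract₀₁ (Xn t) (lineVec d φ) φ = 0) :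
    ∀ φ : Fin 4 → ℂ, contract₀₁ permPattern₄ (lineVec d φ) φ =
      vecMulVec (fun i => ∑ x, lineVec d φ x * b x i) (fun j => ∑ y, φ y * b' y j) +
      vecMulVec (fun i => ∑ y, φ y * c' y i) (fun j => ∑ x, lineVec d φ x * c x j) := by
  intro φ
  rw [contract_congr hsum]
  have : (fun v => (∑ t ∈ N, Xn t v) + b (v 0) (v 2) * b' (v 1) (v 3) + c (v 0) (v 3) * c' (v 1) (v 2)) =
      fun v => ∑ k : Fin 3, (![fun v => ∑ t ∈ N, Xn t v, fun v => b (v 0) (v 2) * b' (v 1) (v 3),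
        fun v => c (v 0) (v 3) * c' (v 1) (v 2)] : Fin 3 → (Fin 4 → Fin 4) → ℂ) k v := by
    funext v; simp [Fin.sum_univ_three]
  rw [contract_congr (fun v => congrFun this v), contract_sum, Fin.sum_univ_three]
  simp only [Matrix.cons_val_zero, Matrix.cons_val_one, Matrix.head_cons, Matrix.cons_val_two, Matrix.tail_cons]
  rw [contract_sum, hid, zero_add, contract_pair02, contract_pair03]

/-- **Dichotomy.**  For a decomposition of `P₄` with at most three noise terms (canonical types `{0}`, `{0,1}`) and
rank-one part `b(v₀,v₂)b′(v₁,v₃) + c(v₀,v₃)c′(v₁,v₂)`, some relabelling `π` of the letters puts the arrays in the normal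
form of `matching_shape` (the star alternative being contradictory). -/
theorem e3_dichotomy {ι : Type*} (N : Finset ι) (Xn : ι → (Fin 4 → Fin 4) → ℂ) (Sn : ι → Finset (Fin 4))
    (hXn : ∀ t ∈ N, IsSplitTerm (Sn t) (Xn t)) (hSn : ∀ t ∈ N, Sn t = {0} ∨ Sn t = {0, 1}) (hN : N.card ≤ 3)
    (b b' c c' : Fin 4 → Fin 4 → ℂ)
    (hsum : ∀ v, permPattern₄ v = (∑ t ∈ N, Xn t v) + b (v 0) (v 2) * b' (v 1) (v 3) + c (v 0) (v 3) * c' (v 1) (v 2)) :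
    ∃ π : Equiv.Perm (Fin 4), let B := fun x z => b (π x) (π z); let B' := fun y w => b' (π y) (π w);
      let C := fun x w => c (π x) (π w); let C' := fun y z => c' (π y) (π z);
    (B 0 0 = 0 ∧ B 1 1 = 0 ∧ B 1 0 = B 0 1 ∧ B 0 2 = 0 ∧ B 0 3 = 0 ∧ B 1 2 = 0 ∧ B 1 3 = 0) ∧
    (C 0 0 = 0 ∧ C 1 1 = 0 ∧ C 1 0 = C 0 1 ∧ C 0 2 = 0 ∧ C 0 3 = 0 ∧ C 1 2 = 0 ∧ C 1 3 = 0) ∧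
    (B' 0 0 = 0 ∧ B' 1 1 = 0 ∧ B' 0 1 = -B' 1 0 ∧ B' 2 0 = 0 ∧ B' 3 0 = 0 ∧ B' 2 1 = 0 ∧ B' 3 1 = 0 ∧
      B' 0 2 = 0 ∧ B' 1 2 = 0 ∧ B' 2 2 = 0 ∧ B' 0 3 = 0 ∧ B' 1 3 = 0 ∧ B' 3 3 = 0 ∧ B' 3 2 = B' 2 3) ∧
    (C' 0 0 = 0 ∧ C' 1 1 = 0 ∧ C' 0 1 = -C' 1 0 ∧ C' 2 0 = 0 ∧ C' 3 0 = 0 ∧ C' 2 1 = 0 ∧ C' 3 1 = 0 ∧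
      C' 0 2 = 0 ∧ C' 1 2 = 0 ∧ C' 2 2 = 0 ∧ C' 0 3 = 0 ∧ C' 1 3 = 0 ∧ C' 3 3 = 0 ∧ C' 3 2 = C' 2 3) ∧
    (B 0 1 * B' 2 3 = 1 ∧ C 0 1 * C' 2 3 = 1 ∧ B 0 1 * B' 1 0 + C 0 1 * C' 1 0 = 0) := by
  classical
  obtain ⟨d, hdvalid, hid, -⟩ := e3_core N Xn Sn hXn hSn hN b b' c c' hsum
  -- transport along a letter relabelling `π` with `permDescr π d₀ = d`
  have key : ∀ (π : Equiv.Perm (Fin 4)) (d₀ : Fin 4 ⊕ (Fin 4 × Fin 4)), permDescr π d₀ = d →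
      ∀ φ : Fin 4 → ℂ, contract₀₁ permPattern₄ (lineVec d₀ φ) φ =
        vecMulVec (fun i => ∑ x, lineVec d₀ φ x * b (π x) (π i)) (fun j => ∑ y, φ y * b' (π y) (π j)) +
        vecMulVec (fun i => ∑ y, φ y * c' (π y) (π i)) (fun j => ∑ x, lineVec d₀ φ x * c (π x) (π j)) := by
    intro π d₀ hπ
    have hid' := noise_identity_letterPerm π N Xn d₀ (by rw [hπ]; exact hid)
    exact q_eq_r_of_noise N (fun t => letterPerm π (Xn t)) (fun x z => b (π x) (π z)) (fun y w => b' (π y) (π w))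
      (fun x w => c (π x) (π w)) (fun y z => c' (π y) (π z)) (hsum_letterPerm π N Xn b b' c c' hsum) d₀ hid'
  rcases d with i | ⟨i, j⟩
  · exact (e3_star _ _ _ _ (key (Equiv.swap 0 i) (Sum.inl 0) (by simp [permDescr]))).elim
  · have hij : i ≠ j := hdvalid (i, j) rfl
    obtain ⟨π, h0, h1⟩ := exists_perm_zero_one i j hij
    exact ⟨π, e3_matching _ _ _ _ (key π (Sum.inr (0, 1)) (by simp [permDescr, h0, h1]))⟩

end LaplaceFourLine

end Summit.ValiantsHypothesis.ValiantsHypothesis.Theorems.RigidityForcesSymmetryRankRigidMinimalRepr
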